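import Summits.CriticalPhenomena.PercolationContinuityZ3.Theses.PercTorusSliceFilling
import Summits.CriticalPhenomena.PercolationContinuityZ3.Theorems.PercTorusSliceFillingNoCriticalTorusGiantUniversalTightness
import Summits.CriticalPhenomena.PercolationContinuityZ3.Theorems.PercTorusSliceFillingNoCriticalTorusGiantSfTransfer
import Summits.CriticalPhenomena.PercolationContinuityZ3.Theorems.PercTorusSliceFillingNoCriticalTorusGiantTransferConverse
import Summits.CriticalPhenomena.PercolationContinuityZ3.Theorems.PercTorusSliceFillingNoCriticalTorusGiantNecessity

/-!
# `Lines/birth.lean` (line `registered`) — skeleton for crux `PercTorusSliceFilling.NoCriticalTorusGiant`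
(item stmt-CriticalPhenomena-5407 · route route-CriticalPhenomena-PercTorusSliceFilling · sub-problem
`PercolationContinuityZ3`)

**Crux (rank 2, T-B of the card, the route's open problem).** `NoCriticalTorusGiant`: for Bernoulli
bond percolation on the discrete torus `T_n = (ℤ/nℤ)³` (`torusGraph 3 n`) at `p_c = criticalProbI 3`,
for every `ε > 0`, `P_{T_n,p_c}(∃ x, |C(x)| ≥ ε n³) → 0` (Easo–Hutchcroft, arXiv:2112.12778 = Duke
Math. J. 173 (2024), Rem. 1.4: open even in the weaker form "no multiple giants").

## State of the line after lead c3's cycle 1 (2026-08-17)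

Everything provable in the line is LANDED under `Theorems/PercTorusSliceFillingNoCriticalTorusGiant*.lean`
(namespace `…Theorems.PercTorusSliceFillingNoCriticalTorusGiant`), all `--supports stmt-CriticalPhenomena-5407`:

* slice-filling transfer (leads c1/c2): S1a `stub_nonSfLargeClusterChart` p146456, S1b
  `stub_nonSfGiantMarkov` p147787, S2a `stub_sfGiantSecondMoment` p146439, S2b `stub_sfMassTransitive`
  p148668; S3 ⇒ crux `noCriticalTorusGiant_of_sfMass_subextensive` (`…SfTransfer.lean`, p154506, c3);
  crux ⇒ S3 and crux ⇔ `χ_{T_n}(p_c) = o(n³)` (`…TransferConverse.lean`, p150460, c2);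
* necessity: `θ(p_c) = 0 ⇒` crux, finite-range domination `P_T(m+1 ≤ |C(x)|) ≤ P_ℤ(|C(0)| ≥ m+1)`
  (`…Necessity.lean`, p150902, c2); sharpened by c3 to **torus giants have density `≤ θ(p)`**:
  F1a `stub_localCountChebyshev` (`…LocalCountChebyshev.lean`, p156013), F1b
  `giantDensity_le_theta_of_localCountChebyshev` (`…GiantDensityLeTheta.lean`, p156304), unconditional
  `giantDensity_le_theta` / `real_giant_tendsto_zero_of_theta_lt` (`…CriticalGiantDensity.lean`): the
  crux holds for every `ε > θ(p_c)`;
* universal-tightness transfer (c3): U1a `stub_clusterExploration` (`…ClusterExploration.lean`,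
  p154833), U1b `stub_parentSplit` (`…ParentSplit.lean`, p155217), the sprinkling-free doubling
  inequality `real_exists_three_mul_le_sq` (`P_{T_n,p}(∃ x, |C(x)| ≥ 3k) ≤ P_{T_n,p}(∃ x, |C(x)| ≥ k)²`,
  Hutchcroft 2021 Thm 2.3, every `p`), its iteration `real_exists_pow_mul_le_pow`, and the certified
  transfer `noCriticalTorusGiant_iff_noGiantWithPositiveProbability` (`…UniversalTightness.lean`,
  p156473).

What remains is ONE registered stub, the residual R `stub_noGiantWithPositiveProbability`: there is
`ρ > 0` such that for every density `a > 0`, eventually in `n`, `P_{T_n,p_c}(∃ x, |C(x)| ≥ a n³) ≤ 1 - ρ`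
— "with probability bounded below the critical torus has no `a`-giant".  It is CERTIFIED
crux-equivalent (`noCriticalTorusGiant_iff_noGiantWithPositiveProbability`), it is the weakest form in
which the Easo–Hutchcroft problem can be stated (their §5 "weaker supercritical existence property"),
and by F1 it can only fail in a discontinuous world `θ(p_c) ≥ a`.  The deciding form
`NoCriticalTorusGiant_of (hR : Sig.stub_noGiantWithPositiveProbability)` below concludes the crux BY
NAME from it, through the landed transfer.

Equivalent registered-grade forms of the residual, all certified in the tree (any one closes the crux):
`χ_{T_n}(p_c)/n³ → 0` (`noCriticalTorusGiant_of_suscept_subextensive`); S3 (slice-filling susceptibility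
subextensive, `noCriticalTorusGiant_of_sfMass_subextensive`); R (this file); `θ(p_c) = 0` (stronger;
`noCriticalTorusGiant_of_theta_eq_zero`).

Disproof / negatives honoured: `Cruxes/NoCriticalTorusGiant/` has no `Disproof.lean`, no
`_false_without_` theorem, no landed `Negative/` lemma, no crux ideas (2026-08-17, `ledger crux ls` /
`ledger crux ideas`).  Typing checklist: R quantifies `∀ a > 0` BEFORE `∀ᶠ n` (a fixed density, then
large tori) — exactly what the doubling iteration consumes; `1 - ρ` may be read with any `ρ ∈ (0,1]`.
-/

namespace Summit.CriticalPhenomena.PercolationContinuityZ3.Cruxes.NoCriticalTorusGiant.Birth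

open MeasureTheory Filter Topology
open Literature.Probability.Percolation Literature.Probability.LatticeModels

/-! ## §0 The stub statement, name-keyed (what `NoCriticalTorusGiant_of` takes) -/

namespace Sig

/-- Name-keyed statement of `stub_noGiantWithPositiveProbability` (R: with probability bounded
below, the critical 3-torus has no cluster of any fixed positive density). [stub statement; open
problem — the residual of the universal-tightness transfer, certified crux-equivalent] -/
def stub_noGiantWithPositiveProbability : Prop :=
  ∃ ρ : ℝ, 0 < ρ ∧ ∀ a : ℝ, 0 < a → ∀ᶠ n : ℕ in atTop,
    (bondPercolation (torusGraph 3 n) (criticalProbI 3)).real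
        {ω | ∃ x : TorusSite 3 n, a * (n : ℝ) ^ 3 ≤ ((openCluster ω x).ncard : ℝ)} ≤ 1 - ρ

end Sig

/-! ## §1 The registered stub (the only admitted declaration of the file) -/

/-- **Stub R — no giant with probability bounded below (LOAD-BEARING; open; the residual of the
universal-tightness transfer).**  There is `ρ > 0` such that for every density `a > 0`, for all
large `n`, `P_{T_n, p_c(ℤ³)}(∃ x, |C(x)| ≥ a n³) ≤ 1 - ρ`.  Certified equivalent to the crux
(`noCriticalTorusGiant_iff_noGiantWithPositiveProbability`, p156473); the weakest form in which the
critical-torus problem of Easo–Hutchcroft 2024 (Rem 1.4) can be stated; false exactly in a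
giant-bearing jump world (`θ(p_c) ≥ a`, by `giantDensity_le_theta`).  Tools that act on it and what
they give today: Aut(T_n)-symmetric sharp thresholds (window WIDTH `≤ C/log n` only), the covering
tower `T_n ← T_{2n}` at fixed `p` (cluster domination upward only), bond/plaquette duality of `T³`
(DKS 2025 Lemma 10: rank identity, nothing at `p_c`), Barsky–Grimmett–Newman half-space
non-percolation at `p_c` (a proven same-`p` "non-triviality" statement, but for half-space blocks,
which a torus giant is not known to force) — see `Cruxes/NoCriticalTorusGiant/S3-research.md` and
`R-memo.md`. [open problem; size: crux-strength] -/
theorem stub_noGiantWithPositiveProbability :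
    ∃ ρ : ℝ, 0 < ρ ∧ ∀ a : ℝ, 0 < a → ∀ᶠ n : ℕ in atTop,
      (bondPercolation (torusGraph 3 n) (criticalProbI 3)).real
          {ω | ∃ x : TorusSite 3 n, a * (n : ℝ) ^ 3 ≤ ((openCluster ω x).ncard : ℝ)} ≤ 1 - ρ := by
  sorry

/-! ## §2 Composition (kernel-checked, now a one-liner through the landed transfer) -/

/-- **Composition (deciding form).**  The residual R implies the crux
`PercTorusSliceFilling.NoCriticalTorusGiant`, concluded BY NAME, through the landed
universal-tightness transfer `noCriticalTorusGiant_of_noGiantWithPositiveProbability`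
(`…UniversalTightness.lean`, p156473: doubling inequality by BK + iteration). [folklore] -/
theorem NoCriticalTorusGiant_of (hR : Sig.stub_noGiantWithPositiveProbability) :
    Summit.CriticalPhenomena.PercolationContinuityZ3.Theses.PercTorusSliceFilling.NoCriticalTorusGiant :=
  Summit.CriticalPhenomena.PercolationContinuityZ3.Theorems.PercTorusSliceFillingNoCriticalTorusGiant.noCriticalTorusGiant_of_noGiantWithPositiveProbability
    hR

/-- The registered stub R, as spelled out, IS `Sig.stub_noGiantWithPositiveProbability`. -/
theorem noGiantWithPositiveProbability_registered : Sig.stub_noGiantWithPositiveProbability :=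
  stub_noGiantWithPositiveProbability

/- The crux from the one registered open stub (an `example`, so no admitted proof of the crux enters
the environment). -/
example :
    Summit.CriticalPhenomena.PercolationContinuityZ3.Theses.PercTorusSliceFilling.NoCriticalTorusGiant :=
  NoCriticalTorusGiant_of noGiantWithPositiveProbability_registered

/- Sanity links to the other certified closing forms (examples only). -/
example (h : theta (zdGraph 3) (0 : Site 3) (criticalProbI 3) = 0) :
    Summit.CriticalPhenomena.PercolationContinuityZ3.Theses.PercTorusSliceFilling.NoCriticalTorusGiant :=
  Summit.CriticalPhenomena.PercolationContinuityZ3.Theorems.PercTorusSliceFillingNoCriticalTorusGiant.noCriticalTorusGiant_of_theta_eq_zero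
    h

example (h : Summit.CriticalPhenomena.PercolationContinuityZ3.Theses.PercTorusSliceFilling.NoCriticalTorusGiant) :
    Sig.stub_noGiantWithPositiveProbability :=
  Summit.CriticalPhenomena.PercolationContinuityZ3.Theorems.PercTorusSliceFillingNoCriticalTorusGiant.noGiantWithPositiveProbability_of_noCriticalTorusGiant
    h

end Summit.CriticalPhenomena.PercolationContinuityZ3.Cruxes.NoCriticalTorusGiant.Birth
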